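import Summits.SmoothPoincare4.SmoothPoincare4.Theorems.RootDecompAEDoublesBeyondShadowTwoLedgerSegments

/-!
# Grade-four ownership ledger `LocalTableLE4 → GradeFourDichotomy` for KMN encoding graphs, part 14/15: the assembly, I: one piece block

§14a Renaming lemmas (`hom_map_eq`, `substHom_map`, `map_mem_closure_of_lkill`), the global letters `gl` of a piece,
the relators of `P(G)` by index, and THE PIECE BLOCK `block_seg`: the local certificate of a piece, transported to its
global letters and owned relators, is a valid segment from any state killing the far ends, the stable letters and the
unused letters.

THE FAMILY (14 modules `Theorems/RootDecompAEDoublesBeyondShadowTwoLedger*.lean` + the closing module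
`Theorems/RootDecompAEDoublesBeyondShadowTwoStubLedgerFour.lean`, one namespace
`Summit.SmoothPoincare4.SmoothPoincare4.Theorems.RootDecompAEDoublesBeyondShadowTwoStubLedgerFour`, linearly chained
imports, split by topic to respect the 400-line bound on proof files).
-/

open Function
open Literature.Topology.FourManifolds

set_option linter.dupNamespace false

noncomputable section

namespace Summit.SmoothPoincare4.SmoothPoincare4.Theorems.RootDecompAEDoublesBeyondShadowTwoStubLedgerFour

/-! ## §14 The assembly: from a structural peeling certificate to an elimination certificate of `P(G₄)` -/

section AssemblyAlgebra

variable {ι κ : Type}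

/-- A homomorphism applied after a renaming is the substitution of the images of the renamed letters. -/
theorem hom_map_eq₄ {H : Type} [Group H] (f : ι → κ) (φ : FreeGroup κ →* H) (w₄ : FreeGroup ι) :
    φ (FreeGroup.map f w₄) = FreeGroup.lift (fun i => φ (FreeGroup.of (f i))) w₄ := by
  have h : φ.comp (FreeGroup.map f) = FreeGroup.lift fun i => φ (FreeGroup.of (f i)) :=
    FreeGroup.ext_hom _ _ fun i => by simp
  exact DFunLike.congr_fun h w₄

/-- NATURALITY of the substitution `x ↦ W⁻¹` under an injective renaming of the letters. -/
theorem substHom_map₄ {a b : ℕ} (f : Fin a → Fin b) (x : Fin a) (W w₄ : FreeGroup (Fin a)) (hf : Function.Injective f) :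
    Roe.substHom (f x) (FreeGroup.map f W) (FreeGroup.map f w₄) = FreeGroup.map f (Roe.substHom x W w₄) := by
  have h : (Roe.substHom (f x) (FreeGroup.map f W)).comp (FreeGroup.map f) =
      (FreeGroup.map f).comp (Roe.substHom x W) := by
    refine FreeGroup.ext_hom _ _ fun i => ?_
    simp only [MonoidHom.coe_comp, Function.comp_apply, FreeGroup.map.of, Roe.substHom_of₄]
    by_cases hi : i = x
    · subst hi; simp
    · simp [hi, hf.ne hi]
  exact DFunLike.congr_fun h w₄

/-- A local word fixed by the killing of the letters `L` is, after renaming, a word in the renamed letters outside `L`;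
if these lie in `S`, the renamed word lies in the subgroup generated by `S`. -/
theorem map_mem_closure_of_lkill {b : ℕ} (f : Fin 5 → Fin b) (L : List (Fin 5)) (W : FreeGroup (Fin 5))
    (hW : lkill L W = W) (S : Set (Fin b)) (hS : ∀ j, j ∉ L → f j ∈ S) :
    FreeGroup.map f W ∈ Subgroup.closure (FreeGroup.of '' S) := by
  rw [← hW]
  unfold lkill
  rw [← hom_lift_eq₄ (FreeGroup.map f)]
  refine FreeGroup.range_lift_le ?_ ⟨W, rfl⟩
  rintro _ ⟨j, rfl⟩
  simp only [Function.comp_apply]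
  by_cases hj : j ∈ L
  · rw [if_pos hj, map_one]; exact one_mem _
  · rw [if_neg hj, FreeGroup.map.of]; exact Subgroup.subset_closure ⟨f j, hS j hj, rfl⟩

/-- Inverting the sign of `sgnw` inverts the word. -/
theorem sgnw_not₄ {α : Type} (w₄ : FreeGroup α) (t : Bool) : (sgnw t w₄)⁻¹ = sgnw (!t) w₄ := by
  cases t <;> simp [sgnw]

end AssemblyAlgebra

namespace ShadowGraph

variable (G₄ : ShadowGraph)

/-- The GLOBAL LETTER of the `j`-th spine letter of piece `v` in `Fin n`. -/
def gl {n : ℕ} (eg : G₄.Gen ≃ Fin n) (v : Fin G₄.k) : Fin 5 → Fin n := fun j => eg (Sum.inl (v, j))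

variable {G₄}

/-- Global letters of one piece are distinct. -/
theorem gl_injective₄ {n : ℕ} (eg : G₄.Gen ≃ Fin n) (v : Fin G₄.k) : Function.Injective (G₄.gl eg v) := by
  intro i j h
  simpa [gl] using h

/-- The relator of a gluing in `P(G₄)`. -/
theorem presentation_inl₄ {n : ℕ} (eg : G₄.Gen ≃ Fin n) (er : G₄.Rel ≃ Fin n) (e : Fin G₄.m) :
    G₄.presentation eg er (er (Sum.inl e)) = FreeGroup.map eg (G₄.gluingRelator e) := by
  simp [presentation, relator]

/-- The one-letter relators of `P(G₄)`: a stable letter of a tree edge, or an unused spine letter. -/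
theorem presentation_inr {n : ℕ} (eg : G₄.Gen ≃ Fin n) (er : G₄.Rel ≃ Fin n)
    (x : {e : Fin G₄.m // G₄.tree e = true} ⊕ {p : Fin G₄.k × Fin 5 // (G₄.piece p.1).rank ≤ (p.2 : ℕ)}) :
    G₄.presentation eg er (er (Sum.inr x)) = FreeGroup.of (eg (G₄.ownLetter (Sum.inr x))) := by
  rcases x with ⟨e, he⟩ | ⟨p, hp⟩
  · simp [presentation, relator, ownLetter, stable]
  · simp [presentation, relator, ownLetter]

/-- The owner letters of the one-letter relators are distinct. -/
theorem ownLetter_inr_injective :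
    Function.Injective fun x : {e : Fin G₄.m // G₄.tree e = true} ⊕ {p : Fin G₄.k × Fin 5 // (G₄.piece p.1).rank ≤ (p.2 : ℕ)} =>
      G₄.ownLetter (Sum.inr x) := by
  rintro (⟨e₁, he₁⟩ | ⟨p₁, hp₁⟩) (⟨e₂, he₂⟩ | ⟨p₂, hp₂⟩) h <;>
    simp only [ownLetter, Sum.inr.injEq, Sum.inl.injEq, reduceCtorEq] at h ⊢
  · subst h; rfl
  · subst h; rfl

/-- Extraction of the four conditions of the local check on a cons. -/
theorem lcheck_cons {p : Piece} {s : LStep} {rest : List LStep} {Λ : Fin 5 → FreeGroup (Fin 5)} {El : List (Fin 5)}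
    (h : lcheck p (s :: rest) Λ El = true) :
    s.letter ∉ El ∧ lkill (s.letter :: El) s.word = s.word ∧
      s.conj * sgnw s.sgn (FreeGroup.lift Λ (p.portWord s.port)) * s.conj⁻¹ = FreeGroup.of s.letter * s.word ∧
        lcheck p rest (fun y => Roe.substHom s.letter s.word (Λ y)) (s.letter :: El) = true := by
  exact (lcheck_cons_iff p s rest Λ El).mp h

/-- Extraction of the final conditions of the local check. -/
theorem lcheck_nil {p : Piece} {Λ : Fin 5 → FreeGroup (Fin 5)} {El : List (Fin 5)} (h : lcheck p [] Λ El = true) :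
    (∀ i : Fin 5, i ∈ El) ∧ ∀ i : Fin 5, Λ i = 1 := by
  rw [lcheck_nil_iff] at h
  exact ⟨fun i => (h i).1, fun i => (h i).2⟩

/-- **THE PIECE BLOCK.**  The local certificate steps of a piece `v`, embedded with the global letters of `v` and
the relators of the owned rows, form a valid segment from any state that kills exactly `E₀` — where `E₀` contains
the stable letters and the far-end letters of the owned rows and the unused letters of `v`, but no used letter of
`v` — and in which the owned relators are unused; the segment ends in the state killing `E₀ ∪ letters(v)` with
exactly the owned relators added.  (Induction over the local step list; the local state `Λ, El` is the restriction
of the global substitution and eliminated set to the letters of `v`.) -/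
theorem block_seg (hself : ∀ e, (G₄.src e).1 ≠ (G₄.tgt e).1) (hI : G₄.PortsInjective) {n : ℕ} (eg : G₄.Gen ≃ Fin n)
    (er : G₄.Rel ≃ Fin n) (v : Fin G₄.k) (own : Finset (Fin G₄.m))
    (hown : ∀ e ∈ own, (G₄.src e).1 = v ∨ (G₄.tgt e).1 = v) (E₀ U₀ : Finset (Fin n))
    (hfar : ∀ e ∈ own, ∀ i, eg (Sum.inl (G₄.other e v, i)) ∈ E₀) (hstab : ∀ e ∈ own, eg (Sum.inr e) ∈ E₀)
    (hused : ∀ i : Fin 5, (i : ℕ) < (G₄.piece v).rank → G₄.gl eg v i ∉ E₀) (hU₀ : ∀ e ∈ own, er (Sum.inl e) ∉ U₀) :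
    ∀ (ls : List LStep) (Λ : Fin 5 → FreeGroup (Fin 5)) (El : List (Fin 5)) (st : Roe.State n),
      lcheck (G₄.piece v) ls Λ El = true →
      (∀ s ∈ ls, ∃ e ∈ own, G₄.uport e v = s.port) → (ls.map LStep.port).Nodup →
      (∀ i, st.1 (FreeGroup.of (G₄.gl eg v i)) = FreeGroup.map (G₄.gl eg v) (Λ i)) →
      (∀ y, (∀ i, y ≠ G₄.gl eg v i) → st.1 (FreeGroup.of y) = if y ∈ E₀ then 1 else FreeGroup.of y) →
      (∀ y, y ∈ st.2.1 ↔ y ∈ E₀ ∨ ∃ i ∈ El, y = G₄.gl eg v i) →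
      (∀ i : Fin 5, (G₄.piece v).rank ≤ (i : ℕ) → i ∈ El) →
      (∀ r, r ∈ st.2.2 ↔ r ∈ U₀ ∨ ∃ e ∈ own, G₄.uport e v ∉ ls.map LStep.port ∧ r = er (Sum.inl e)) →
      ∃ seg : List (Roe.Step n), Roe.SegValid (G₄.presentation eg er) seg st ∧
        Roe.Kills (Roe.endState seg st).1 (Roe.endState seg st).2.1 ∧
        (∀ y, y ∈ (Roe.endState seg st).2.1 ↔ y ∈ E₀ ∨ ∃ i, y = G₄.gl eg v i) ∧
        (∀ r, r ∈ (Roe.endState seg st).2.2 ↔ r ∈ U₀ ∨ ∃ e ∈ own, r = er (Sum.inl e)) := by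
  classical
  intro ls
  induction ls with
  | nil =>
    intro Λ El st hch _ _ hΦa hΦb hE _ hU
    obtain ⟨hEl, hΛ⟩ := lcheck_nil hch
    refine ⟨[], Roe.segValid_nil₄, ?_, ?_, ?_⟩
    · rw [Roe.endState_nil₄]
      intro y
      by_cases hy : ∃ i, y = G₄.gl eg v i
      · obtain ⟨i, rfl⟩ := hy
        rw [hΦa i, hΛ i, map_one, if_pos ((hE _).mpr (Or.inr ⟨i, hEl i, rfl⟩))]
      · push Not at hy
        rw [hΦb y hy]
        have : y ∈ st.2.1 ↔ y ∈ E₀ := by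
          rw [hE]
          constructor
          · rintro (h | ⟨i, -, h⟩); exacts [h, absurd h (hy i)]
          · exact Or.inl
        simp only [this]
    · rw [Roe.endState_nil₄]
      intro y
      rw [hE y]
      constructor
      · rintro (h | ⟨i, -, h⟩); exacts [Or.inl h, Or.inr ⟨i, h⟩]
      · rintro (h | ⟨i, h⟩); exacts [Or.inl h, Or.inr ⟨i, hEl i, h⟩]
    · rw [Roe.endState_nil₄]
      intro r
      rw [hU r]
      simp
  | cons s rest ih =>
    intro Λ El st hch hports hnd hΦa hΦb hE hlun hU
    obtain ⟨c1, c2, c3, c4⟩ := lcheck_cons hch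
    obtain ⟨es, hes, hpes⟩ := hports s List.mem_cons_self
    rw [List.map_cons, List.nodup_cons] at hnd
    obtain ⟨hsport, hnd'⟩ := hnd
    have hsl : ((s.letter : Fin 5) : ℕ) < (G₄.piece v).rank := by
      by_contra h
      exact c1 (hlun s.letter (not_lt.mp h))
    -- the global step
    let gs : Roe.Step n :=
      ⟨er (Sum.inl es), G₄.gl eg v s.letter, FreeGroup.map (G₄.gl eg v) s.word, G₄.uflip es v == s.sgn⟩
    -- (a) the letter is fresh
    have ha : G₄.gl eg v s.letter ∉ st.2.1 := by
      rw [hE]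
      rintro (h | ⟨i, hi, h⟩)
      · exact hused s.letter hsl h
      · exact c1 (gl_injective₄ eg v h ▸ hi)
    -- (b) the relator is unused
    have hb : er (Sum.inl es) ∉ st.2.2 := by
      rw [hU]
      rintro (h | ⟨e, he, hne, h⟩)
      · exact hU₀ es hes h
      · have hees : e = es := Sum.inl_injective (er.injective h).symm
        subst hees
        exact hne (by rw [hpes]; exact List.mem_cons_self)
    -- (c) the word avoids the eliminated letters and the new letter
    have hc : FreeGroup.map (G₄.gl eg v) s.word ∈
        Subgroup.closure (FreeGroup.of '' {y : Fin n | y ∉ st.2.1 ∧ y ≠ G₄.gl eg v s.letter}) := by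
      refine map_mem_closure_of_lkill (G₄.gl eg v) (s.letter :: El) s.word c2 _ fun j hj => ?_
      rw [List.mem_cons, not_or] at hj
      refine ⟨fun h => ?_, fun h => hj.1 (gl_injective₄ eg v h)⟩
      rw [hE] at h
      rcases h with h | ⟨i, hi, h⟩
      · have hj' : ((j : Fin 5) : ℕ) < (G₄.piece v).rank := by
          by_contra h'
          exact hj.2 (hlun j (not_lt.mp h'))
        exact hused j hj' h
      · exact hj.2 (gl_injective₄ eg v h ▸ hi)
    -- (d) the relator image is conjugate to `(x · W)^{±1}`
    have hrel : st.1 (G₄.presentation eg er (er (Sum.inl es))) =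
        sgnw (G₄.uflip es v) (FreeGroup.map (G₄.gl eg v) (FreeGroup.lift Λ ((G₄.piece v).portWord s.port))) := by
      rw [presentation_inl₄, hom_map_eq₄ eg st.1]
      rw [lift_rel_u₄ (hown es hes) (hself es) (fun g => st.1 (FreeGroup.of (eg g))) ?_ ?_]
      · have hcomp : (fun g => st.1 (FreeGroup.of (eg g))) ∘ G₄.ltr v = ⇑(FreeGroup.map (G₄.gl eg v)) ∘ Λ :=
          funext fun j => hΦa j
        rw [hcomp, hom_lift_eq₄ (FreeGroup.map (G₄.gl eg v)) Λ, uword, hpes]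
      · rw [hΦb _ fun i h => by simp [gl] at h, if_pos (hstab es hes)]
      · intro i
        have hne : ∀ j, eg (Sum.inl (G₄.other es v, i)) ≠ G₄.gl eg v j := by
          intro j h
          have := other_ne₄ (u := v) (hself es)
          simp [gl] at h
          exact this h.1
        rw [hΦb _ hne, if_pos (hfar es hes i)]
    have hloc : IsConj (sgnw s.sgn (FreeGroup.map (G₄.gl eg v) (FreeGroup.lift Λ ((G₄.piece v).portWord s.port))))
        (FreeGroup.of (G₄.gl eg v s.letter) * FreeGroup.map (G₄.gl eg v) s.word) := by
      refine isConj_iff.mpr ⟨FreeGroup.map (G₄.gl eg v) s.conj, ?_⟩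
      have := congrArg (FreeGroup.map (G₄.gl eg v)) c3
      simpa [map_mul, map_inv, hom_sgnw₄] using this
    have hd : IsConj (st.1 (G₄.presentation eg er gs.rel))
        (if gs.sgn then FreeGroup.of gs.letter * gs.word else (FreeGroup.of gs.letter * gs.word)⁻¹) := by
      change IsConj (st.1 (G₄.presentation eg er (er (Sum.inl es))))
        (if (G₄.uflip es v == s.sgn) then FreeGroup.of (G₄.gl eg v s.letter) * FreeGroup.map (G₄.gl eg v) s.word
          else (FreeGroup.of (G₄.gl eg v s.letter) * FreeGroup.map (G₄.gl eg v) s.word)⁻¹)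
      rw [hrel]
      by_cases hsg : G₄.uflip es v = s.sgn
      · rw [hsg, beq_self_eq_true, if_pos rfl]
        exact hloc
      · have hsg' : G₄.uflip es v = !s.sgn := by
          clear hrel hloc hc hb ha hΦa hΦb hE hU hch c2 c3 c4 ih
          cases h1 : G₄.uflip es v <;> cases h2 : s.sgn <;> first | rfl | exact absurd (h1.trans h2.symm) hsg
        have hb' : ((!s.sgn) == s.sgn) = false := by cases s.sgn <;> rfl
        rw [hsg', ← sgnw_not₄, hb', if_neg Bool.false_ne_true]
        exact Roe.isConj_inv_iff₄.mpr hloc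
    have hstep : Roe.StepOK (G₄.presentation eg er) gs st := ⟨ha, hb, hc, hd⟩
    -- the induction hypothesis from the next state
    have hports' : ∀ s' ∈ rest, ∃ e ∈ own, G₄.uport e v = s'.port := fun s' hs' =>
      hports s' (List.mem_cons_of_mem _ hs')
    have hΦa' : ∀ i, (Roe.next gs st).1 (FreeGroup.of (G₄.gl eg v i)) =
        FreeGroup.map (G₄.gl eg v) (Roe.substHom s.letter s.word (Λ i)) := by
      intro i
      change Roe.substHom (G₄.gl eg v s.letter) (FreeGroup.map (G₄.gl eg v) s.word) (st.1 (FreeGroup.of (G₄.gl eg v i))) = _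
      rw [hΦa i, substHom_map₄ (G₄.gl eg v) (hf := gl_injective₄ eg v)]
    have hΦb' : ∀ y, (∀ i, y ≠ G₄.gl eg v i) →
        (Roe.next gs st).1 (FreeGroup.of y) = if y ∈ E₀ then 1 else FreeGroup.of y := by
      intro y hy
      change Roe.substHom (G₄.gl eg v s.letter) (FreeGroup.map (G₄.gl eg v) s.word) (st.1 (FreeGroup.of y)) = _
      rw [hΦb y hy]
      split_ifs with h
      · rw [map_one]
      · rw [Roe.substHom_of₄, if_neg (hy s.letter)]
    have hE' : ∀ y, y ∈ (Roe.next gs st).2.1 ↔ y ∈ E₀ ∨ ∃ i ∈ s.letter :: El, y = G₄.gl eg v i := by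
      intro y
      change y ∈ insert (G₄.gl eg v s.letter) st.2.1 ↔ _
      rw [Finset.mem_insert, hE y]
      constructor
      · rintro (rfl | h | ⟨i, hi, rfl⟩)
        · exact Or.inr ⟨s.letter, List.mem_cons_self, rfl⟩
        · exact Or.inl h
        · exact Or.inr ⟨i, List.mem_cons_of_mem _ hi, rfl⟩
      · rintro (h | ⟨i, hi, rfl⟩)
        · exact Or.inr (Or.inl h)
        · rcases List.mem_cons.mp hi with rfl | hi
          · exact Or.inl rfl
          · exact Or.inr (Or.inr ⟨i, hi, rfl⟩)
    have hlun' : ∀ i : Fin 5, (G₄.piece v).rank ≤ (i : ℕ) → i ∈ s.letter :: El := fun i hi =>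
      List.mem_cons_of_mem _ (hlun i hi)
    have hU' : ∀ r, r ∈ (Roe.next gs st).2.2 ↔
        r ∈ U₀ ∨ ∃ e ∈ own, G₄.uport e v ∉ rest.map LStep.port ∧ r = er (Sum.inl e) := by
      intro r
      change r ∈ insert (er (Sum.inl es)) st.2.2 ↔ _
      rw [Finset.mem_insert, hU r]
      constructor
      · rintro (rfl | h | ⟨e, he, hne, rfl⟩)
        · exact Or.inr ⟨es, hes, by rwa [hpes], rfl⟩
        · exact Or.inl h
        · exact Or.inr ⟨e, he, fun h => hne (List.mem_cons_of_mem _ h), rfl⟩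
      · rintro (h | ⟨e, he, hne, rfl⟩)
        · exact Or.inr (Or.inl h)
        · by_cases hp : G₄.uport e v = s.port
          · have hees : e = es := by
              by_contra hne'
              exact uport_ne₄ hI hne' (hown e he) (hown es hes) (hp.trans hpes.symm)
            subst hees
            exact Or.inl rfl
          · exact Or.inr (Or.inr ⟨e, he, fun h => (List.mem_cons.mp h).elim hp hne, rfl⟩)
    obtain ⟨seg, hseg, hK, hEf, hUf⟩ := ih _ _ (Roe.next gs st) c4 hports' hnd' hΦa' hΦb' hE' hlun' hU'
    refine ⟨gs :: seg, Roe.segValid_cons_iff₄.mpr ⟨hstep, hseg⟩, ?_, ?_, ?_⟩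
    · rw [Roe.endState_cons₄]; exact hK
    · rw [Roe.endState_cons₄]; exact hEf
    · rw [Roe.endState_cons₄]; exact hUf

end ShadowGraph

end Summit.SmoothPoincare4.SmoothPoincare4.Theorems.RootDecompAEDoublesBeyondShadowTwoStubLedgerFour
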